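import Mathlib
import Summits.Ventures.PercRepro2.Defs
import Summits.Ventures.PercRepro2.Harris
import Summits.Ventures.PercRepro2.CoinDefs
import Summits.Ventures.PercRepro2.CoinArcsOff
import Summits.Ventures.PercRepro2.CoinPendantDefs
import Summits.Ventures.PercRepro2.CoinPendant
import Summits.Ventures.PercRepro2.CoinInduced
import Summits.Ventures.PercRepro2.CoinVdBK
import Summits.Ventures.PercRepro2.CoinBHK
import Summits.Ventures.PercRepro2.CoinReverse
import Summits.Ventures.PercRepro2.CoinLemmaA
import Summits.Ventures.PercRepro2.CoinDarcMixed
import Summits.Ventures.PercRepro2.CoinTwoPendantDefs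
import Summits.Ventures.PercRepro2.CoinTwoPendantAlg
import Summits.Ventures.PercRepro2.CoinTwoPendantStep
import Summits.Ventures.PercRepro2.CoinTwoPendantMass
import Summits.Ventures.PercRepro2.CoinTwoPendantPA

/-!
# Row 2′DARC at every TWO-VERTEX pendant head, on mixed coin systems (blind cell PercRepro2,
night-2 g3; proofs/NIGHT2-DARC.md §16)

THEOREM `darc_of_twoPendant_mixed`. Let `D` be a `SameEnds` (mixed) coin system with root `s`,
single target `t`, markers `a, b`, and let `P = {w, v}` (`w ≠ v`) be CLOSED OUT into `{t}` (every
arc with tail in `P` lands in `P ∪ {t}`; the coins carrying such arcs have all their tails in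
`P ∪ {t}`) — arcs INTO `P` from outside are arbitrary.  Let `a, b, u ∉ P ∪ {t}`.  Then
`Φ_D({s ↛ t in D + (u → w)}) ≥ 0` (row 2′DARC), given the non-degeneracy of the six reduced
avoidance events `R^{D₀}_X`, `X ∈ {t, vt, wt, wvt, uwt, uwvt}`, `D₀ = arcsOff arcs (P ∪ {t})`.

This covers, with ONE proof, every pendant head on two vertices: the triangle `w → v, w → t, v → t`,
the pendant path `w → v → t` (`darc_of_path_mixed`), the pair `{w ↔ v}` with exits, two sinks, a
sink with an idle partner — and it is the first kernel-checked case in which the trace family of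
the backward cluster is NOT a chain, so the chain lemma does not apply: the proof uses positive
association of the TRACE LAW (`trace_bhk`, directed BHK for `K⁻` in the T-frame) through the sign
argument of NIGHT2-DARC.md §15.7–15.8, packaged as the four-trace algebra `twoPendant_alg`.

Inputs, all kernel-checked earlier: `avoid_eq_levels` / `gate_eq_levels` and the mass
factorisation `twoPendant_mass` / tower identity `twoPendant_tower` (`CoinTwoPendantMass.lean`);
`trace_bhk` applied to step functions of the trace (`twoPendant_pa`, `twoPendant_pa_w`,
`CoinTwoPendantPA.lean`) — the
three positive-association facts of the trace law; `vdBKC` with `A = B = ∅` — the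
log-supermodularity `P(R_{uwt}) P(R_{wvt}) ≤ P(R_{wt}) P(R_{uwvt})`; `covC_nonneg` /
`shift_avoid_more_C` on `D₀` — the inner covariances and the Lemma-A shift orderings.
-/

namespace Summit.Ventures.PercRepro2.Coin

section Theorem

open Classical

variable {V : Type*} {E : Type*} [Fintype V] [DecidableEq V] [Fintype E] [DecidableEq E]
  {R : Type*} [Field R] [LinearOrder R] [IsStrictOrderedRing R]

/-- **THEOREM (row 2′DARC at every two-vertex pendant head, mixed coin systems).** `P = {w, v}`
closed out into the single target `t` with mixed pendant coins, `a, b, u ∉ P ∪ {t}`; then the gate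
functional of the arc `u → w` is nonnegative, `DARC p arcs s {t} a b u w`, on every `SameEnds`
coin system, given the non-degeneracy of the six reduced avoidance events. -/
theorem darc_of_twoPendant_mixed (p : E → R) (hp : IsProbVec p) {arcs : E → Finset (V × V)}
    (hS : SameEnds arcs) (s a b u w v t : V) (hwv : w ≠ v)
    (hclosed : ClosedOut arcs {w, v} {t}) (hT : TailCoinsIn arcs {w, v} {t})
    (ha : a ∉ ({w, v} : Finset V) ∪ {t}) (hb : b ∉ ({w, v} : Finset V) ∪ {t})
    (hu : u ∉ ({w, v} : Finset V) ∪ {t})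
    (hP₀ : 0 < prob p (avoidEvent (arcsOff arcs ({w, v} ∪ {t})) s {t}))
    (hP₁ : 0 < prob p (avoidEvent (arcsOff arcs ({w, v} ∪ {t})) s (insert v {t})))
    (hP₂ : 0 < prob p (avoidEvent (arcsOff arcs ({w, v} ∪ {t})) s (insert w {t})))
    (hP₃ : 0 < prob p (avoidEvent (arcsOff arcs ({w, v} ∪ {t})) s (insert w (insert v {t}))))
    (hQ₂ : 0 < prob p (avoidEvent (arcsOff arcs ({w, v} ∪ {t})) s (insert u (insert w {t}))))
    (hQ₃ : 0 < prob p (avoidEvent (arcsOff arcs ({w, v} ∪ {t})) s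
      (insert u (insert w (insert v {t}))))) :
    DARC p arcs s {t} a b u w := by
  have hS₀ : SameEnds (arcsOff arcs ({w, v} ∪ {t})) := sameEnds_arcsOff hS _
  have huw : u ≠ w := fun h => hu (by rw [h]; simp)
  have huv : u ≠ v := fun h => hu (by rw [h]; simp)
  have hut : u ≠ t := fun h => hu (by rw [h]; simp)
  -- the reduced system, markers, events
  set D₀ := arcsOff arcs ({w, v} ∪ {t}) with hD₀
  set X₀ : Config E → R := marker D₀ s a with hX₀
  set Y₀ : Config E → R := marker D₀ s b with hY₀
  set R₀ := avoidEvent D₀ s {t} with hR₀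
  set R₁ := avoidEvent D₀ s (insert v {t}) with hR₁
  set R₂ := avoidEvent D₀ s (insert w {t}) with hR₂
  set R₃ := avoidEvent D₀ s (insert w (insert v {t})) with hR₃
  set R₂' := avoidEvent D₀ s (insert u (insert w {t})) with hR₂'
  set R₃' := avoidEvent D₀ s (insert u (insert w (insert v {t}))) with hR₃'
  set L₀ := lvl₀ arcs {t} w v with hL₀
  set L₁ := lvl₁ arcs {t} w v with hL₁
  set L₂ := lvl₂ arcs {t} w v with hL₂
  set L₃ := lvl₃ arcs {t} w v with hL₃
  -- level masses
  have hℓ₀ : 0 ≤ prob p L₀ := prob_nonneg hp _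
  have hℓ₁ : 0 ≤ prob p L₁ := prob_nonneg hp _
  have hℓ₂ : 0 ≤ prob p L₂ := prob_nonneg hp _
  have hℓ₃ : 0 ≤ prob p L₃ := prob_nonneg hp _
  have hΛ : 0 < prob p L₀ * prob p R₀ + prob p L₁ * prob p R₁ + prob p L₂ * prob p R₂
      + prob p L₃ * prob p R₃ := twoPendant_lambda_pos p hp arcs w v t hP₀ hP₁ hP₂ hP₃
  -- monotonicity in the avoided set and log-supermodularity (`vdBKC`, `A = B = ∅`)
  have hQ₃P : prob p R₃' ≤ prob p R₃ :=
    prob_mono hp fun ω h t' ht' => h t' (Finset.mem_insert_of_mem ht')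
  have hρ : prob p R₂' * prob p R₃ ≤ prob p R₂ * prob p R₃' := by
    have h := vdBKC p hp hS₀ s ∅ ∅ (insert u (insert w {t})) (insert w (insert v {t}))
    simp only [connAllC_empty, Set.univ_inter, Finset.empty_union] at h
    rw [twoPendant_inter_eq huw huv hut, twoPendant_union_eq] at h
    exact h
  -- inner covariances (directed BHK on `D₀`)
  have hcov₀ : 0 ≤ prob p R₀ * massE p (fun ω => X₀ ω * Y₀ ω) R₀
      - massE p X₀ R₀ * massE p Y₀ R₀ := by
    have h := covC_nonneg p hp hS₀ s a b {t}
    simp only [covC] at h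
    exact h
  have hcov₁ : 0 ≤ prob p R₁ * massE p (fun ω => X₀ ω * Y₀ ω) R₁
      - massE p X₀ R₁ * massE p Y₀ R₁ := by
    have h := covC_nonneg p hp hS₀ s a b (insert v {t})
    simp only [covC] at h
    exact h
  have hcov₂' : 0 ≤ prob p R₂' * massE p (fun ω => X₀ ω * Y₀ ω) R₂'
      - massE p X₀ R₂' * massE p Y₀ R₂' := by
    have h := covC_nonneg p hp hS₀ s a b (insert u (insert w {t}))
    simp only [covC] at h
    exact h
  have hcov₃' : 0 ≤ prob p R₃' * massE p (fun ω => X₀ ω * Y₀ ω) R₃'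
      - massE p X₀ R₃' * massE p Y₀ R₃' := by
    have h := covC_nonneg p hp hS₀ s a b (insert u (insert w (insert v {t})))
    simp only [covC] at h
    exact h
  -- Lemma-A shift orderings of the conditional means (cleared forms)
  have hsub₀₁ : ({t} : Finset V) ⊆ insert v {t} := Finset.subset_insert v {t}
  have hsub₀₂ : ({t} : Finset V) ⊆ insert w {t} := Finset.subset_insert w {t}
  have hsub₁₃ : (insert v {t} : Finset V) ⊆ insert w (insert v {t}) := Finset.subset_insert _ _
  have hsub₂₃ : (insert w {t} : Finset V) ⊆ insert w (insert v {t}) :=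
    Finset.insert_subset_insert w (Finset.subset_insert v {t})
  have hsub₂₂' : (insert w {t} : Finset V) ⊆ insert u (insert w {t}) := Finset.subset_insert _ _
  have hsub₃₃' : (insert w (insert v {t}) : Finset V) ⊆ insert u (insert w (insert v {t})) :=
    Finset.subset_insert _ _
  have hsub₂'₃' : (insert u (insert w {t}) : Finset V) ⊆ insert u (insert w (insert v {t})) :=
    Finset.insert_subset_insert u (Finset.insert_subset_insert w (Finset.subset_insert v {t}))
  have hA₀₁ := shift_avoid_more_C p hp hS₀ s a hsub₀₁
  have hA₀₂ := shift_avoid_more_C p hp hS₀ s a hsub₀₂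
  have hA₁₃ := shift_avoid_more_C p hp hS₀ s a hsub₁₃
  have hA₂₃ := shift_avoid_more_C p hp hS₀ s a hsub₂₃
  have hA₂' := shift_avoid_more_C p hp hS₀ s a hsub₂₂'
  have hA₃' := shift_avoid_more_C p hp hS₀ s a hsub₃₃'
  have hA₂'₃' := shift_avoid_more_C p hp hS₀ s a hsub₂'₃'
  have hB₀₁ := shift_avoid_more_C p hp hS₀ s b hsub₀₁
  have hB₀₂ := shift_avoid_more_C p hp hS₀ s b hsub₀₂
  have hB₁₃ := shift_avoid_more_C p hp hS₀ s b hsub₁₃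
  have hB₂₃ := shift_avoid_more_C p hp hS₀ s b hsub₂₃
  have hB₂' := shift_avoid_more_C p hp hS₀ s b hsub₂₂'
  have hB₃' := shift_avoid_more_C p hp hS₀ s b hsub₃₃'
  have hB₂'₃' := shift_avoid_more_C p hp hS₀ s b hsub₂'₃'
  -- the conditional means, their order and their bound `≤ 1`
  have hx₁₀ : massE p X₀ R₁ / prob p R₁ ≤ massE p X₀ R₀ / prob p R₀ :=
    (div_le_div_iff₀ hP₁ hP₀).mpr hA₀₁
  have hx₂₀ : massE p X₀ R₂ / prob p R₂ ≤ massE p X₀ R₀ / prob p R₀ :=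
    (div_le_div_iff₀ hP₂ hP₀).mpr hA₀₂
  have hx₃₁ : massE p X₀ R₃ / prob p R₃ ≤ massE p X₀ R₁ / prob p R₁ :=
    (div_le_div_iff₀ hP₃ hP₁).mpr hA₁₃
  have hx₃₂ : massE p X₀ R₃ / prob p R₃ ≤ massE p X₀ R₂ / prob p R₂ :=
    (div_le_div_iff₀ hP₃ hP₂).mpr hA₂₃
  have hx₂'₂ : massE p X₀ R₂' / prob p R₂' ≤ massE p X₀ R₂ / prob p R₂ :=
    (div_le_div_iff₀ hQ₂ hP₂).mpr hA₂'
  have hx₃'₃ : massE p X₀ R₃' / prob p R₃' ≤ massE p X₀ R₃ / prob p R₃ :=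
    (div_le_div_iff₀ hQ₃ hP₃).mpr hA₃'
  have hx₃'₂' : massE p X₀ R₃' / prob p R₃' ≤ massE p X₀ R₂' / prob p R₂' :=
    (div_le_div_iff₀ hQ₃ hQ₂).mpr hA₂'₃'
  have hy₁₀ : massE p Y₀ R₁ / prob p R₁ ≤ massE p Y₀ R₀ / prob p R₀ :=
    (div_le_div_iff₀ hP₁ hP₀).mpr hB₀₁
  have hy₂₀ : massE p Y₀ R₂ / prob p R₂ ≤ massE p Y₀ R₀ / prob p R₀ :=
    (div_le_div_iff₀ hP₂ hP₀).mpr hB₀₂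
  have hy₃₁ : massE p Y₀ R₃ / prob p R₃ ≤ massE p Y₀ R₁ / prob p R₁ :=
    (div_le_div_iff₀ hP₃ hP₁).mpr hB₁₃
  have hy₃₂ : massE p Y₀ R₃ / prob p R₃ ≤ massE p Y₀ R₂ / prob p R₂ :=
    (div_le_div_iff₀ hP₃ hP₂).mpr hB₂₃
  have hy₂'₂ : massE p Y₀ R₂' / prob p R₂' ≤ massE p Y₀ R₂ / prob p R₂ :=
    (div_le_div_iff₀ hQ₂ hP₂).mpr hB₂'
  have hy₃'₃ : massE p Y₀ R₃' / prob p R₃' ≤ massE p Y₀ R₃ / prob p R₃ :=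
    (div_le_div_iff₀ hQ₃ hP₃).mpr hB₃'
  have hy₃'₂' : massE p Y₀ R₃' / prob p R₃' ≤ massE p Y₀ R₂' / prob p R₂' :=
    (div_le_div_iff₀ hQ₃ hQ₂).mpr hB₂'₃'
  have hx₀1 : massE p X₀ R₀ / prob p R₀ ≤ 1 :=
    (div_le_one₀ hP₀).mpr (massE_marker_le_prob p hp D₀ s a R₀)
  have hx₁1 : massE p X₀ R₁ / prob p R₁ ≤ 1 :=
    (div_le_one₀ hP₁).mpr (massE_marker_le_prob p hp D₀ s a R₁)
  have hx₂1 : massE p X₀ R₂ / prob p R₂ ≤ 1 :=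
    (div_le_one₀ hP₂).mpr (massE_marker_le_prob p hp D₀ s a R₂)
  have hx₃1 : massE p X₀ R₃ / prob p R₃ ≤ 1 :=
    (div_le_one₀ hP₃).mpr (massE_marker_le_prob p hp D₀ s a R₃)
  have hx₂'1 : massE p X₀ R₂' / prob p R₂' ≤ 1 :=
    (div_le_one₀ hQ₂).mpr (massE_marker_le_prob p hp D₀ s a R₂')
  have hx₃'1 : massE p X₀ R₃' / prob p R₃' ≤ 1 :=
    (div_le_one₀ hQ₃).mpr (massE_marker_le_prob p hp D₀ s a R₃')
  have hy₀1 : massE p Y₀ R₀ / prob p R₀ ≤ 1 :=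
    (div_le_one₀ hP₀).mpr (massE_marker_le_prob p hp D₀ s b R₀)
  have hy₁1 : massE p Y₀ R₁ / prob p R₁ ≤ 1 :=
    (div_le_one₀ hP₁).mpr (massE_marker_le_prob p hp D₀ s b R₁)
  have hy₂1 : massE p Y₀ R₂ / prob p R₂ ≤ 1 :=
    (div_le_one₀ hP₂).mpr (massE_marker_le_prob p hp D₀ s b R₂)
  have hy₃1 : massE p Y₀ R₃ / prob p R₃ ≤ 1 :=
    (div_le_one₀ hP₃).mpr (massE_marker_le_prob p hp D₀ s b R₃)
  have hy₂'1 : massE p Y₀ R₂' / prob p R₂' ≤ 1 :=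
    (div_le_one₀ hQ₂).mpr (massE_marker_le_prob p hp D₀ s b R₂')
  have hy₃'1 : massE p Y₀ R₃' / prob p R₃' ≤ 1 :=
    (div_le_one₀ hQ₃).mpr (massE_marker_le_prob p hp D₀ s b R₃')
  -- the step functionals `1 − x`, `1 − y`, `1 − x̃`, `1 − ỹ`, `1[w ∈ ·]`
  have hmonX : Monotone (stepFn w v (1 - massE p X₀ R₀ / prob p R₀)
      (1 - massE p X₀ R₁ / prob p R₁) (1 - massE p X₀ R₂ / prob p R₂)
      (1 - massE p X₀ R₃ / prob p R₃)) :=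
    monotone_stepFn (sub_le_sub_left hx₁₀ 1) (sub_le_sub_left hx₂₀ 1)
      (sub_le_sub_left hx₃₁ 1) (sub_le_sub_left hx₃₂ 1)
  have hmonY : Monotone (stepFn w v (1 - massE p Y₀ R₀ / prob p R₀)
      (1 - massE p Y₀ R₁ / prob p R₁) (1 - massE p Y₀ R₂ / prob p R₂)
      (1 - massE p Y₀ R₃ / prob p R₃)) :=
    monotone_stepFn (sub_le_sub_left hy₁₀ 1) (sub_le_sub_left hy₂₀ 1)
      (sub_le_sub_left hy₃₁ 1) (sub_le_sub_left hy₃₂ 1)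
  have hmonX' : Monotone (stepFn w v (1 - massE p X₀ R₀ / prob p R₀)
      (1 - massE p X₀ R₁ / prob p R₁) (1 - massE p X₀ R₂' / prob p R₂')
      (1 - massE p X₀ R₃' / prob p R₃')) :=
    monotone_stepFn (sub_le_sub_left hx₁₀ 1) (sub_le_sub_left (hx₂'₂.trans hx₂₀) 1)
      (sub_le_sub_left (hx₃'₃.trans hx₃₁) 1) (sub_le_sub_left hx₃'₂' 1)
  have hmonY' : Monotone (stepFn w v (1 - massE p Y₀ R₀ / prob p R₀)
      (1 - massE p Y₀ R₁ / prob p R₁) (1 - massE p Y₀ R₂' / prob p R₂')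
      (1 - massE p Y₀ R₃' / prob p R₃')) :=
    monotone_stepFn (sub_le_sub_left hy₁₀ 1) (sub_le_sub_left (hy₂'₂.trans hy₂₀) 1)
      (sub_le_sub_left (hy₃'₃.trans hy₃₁) 1) (sub_le_sub_left hy₃'₂' 1)
  have hmonW : Monotone (stepFn w v (0 : R) 0 1 1) :=
    monotone_stepFn le_rfl zero_le_one zero_le_one le_rfl
  have hnnX := stepFn_nonneg (w := w) (v := v) (sub_nonneg.mpr hx₀1) (sub_nonneg.mpr hx₁1)
    (sub_nonneg.mpr hx₂1) (sub_nonneg.mpr hx₃1)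
  have hnnY := stepFn_nonneg (w := w) (v := v) (sub_nonneg.mpr hy₀1) (sub_nonneg.mpr hy₁1)
    (sub_nonneg.mpr hy₂1) (sub_nonneg.mpr hy₃1)
  have hnnX' := stepFn_nonneg (w := w) (v := v) (sub_nonneg.mpr hx₀1) (sub_nonneg.mpr hx₁1)
    (sub_nonneg.mpr hx₂'1) (sub_nonneg.mpr hx₃'1)
  have hnnY' := stepFn_nonneg (w := w) (v := v) (sub_nonneg.mpr hy₀1) (sub_nonneg.mpr hy₁1)
    (sub_nonneg.mpr hy₂'1) (sub_nonneg.mpr hy₃'1)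
  have hnnW := stepFn_nonneg (w := w) (v := v) (R := R) le_rfl le_rfl zero_le_one zero_le_one
  -- the three positive-association inputs of the trace law
  have hPAN := twoPendant_pa_w p hp hS hclosed hT hwv s hmonX hmonY hnnX hnnY
  have hshA := twoPendant_pa p hp hS hclosed hT hwv s hmonX hmonW hnnX hnnW
  have hshB := twoPendant_pa p hp hS hclosed hT hwv s hmonY hmonW hnnY hnnW
  have hPAU := twoPendant_pa p hp hS hclosed hT hwv s hmonX' hmonY' hnnX' hnnY'
  simp only [stepFn_empty, stepFn_v hwv, stepFn_w hwv, stepFn_wv, zero_mul, mul_zero, one_mul,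
    mul_one, zero_add, add_zero] at hPAN hshA hshB hPAU
  -- the masses on `R_T` and on the gate event (factorised over the levels)
  have hdepX : DependsOn X₀ (tailCoins arcs {w, v})ᶜ := twoPendant_dependsOn_marker hT s a
  have hdepY : DependsOn Y₀ (tailCoins arcs {w, v})ᶜ := twoPendant_dependsOn_marker hT s b
  have hdepXY : DependsOn (fun ω => X₀ ω * Y₀ ω) (tailCoins arcs {w, v})ᶜ := fun ω ω' h => by
    show X₀ ω * Y₀ ω = X₀ ω' * Y₀ ω'
    rw [hdepX h, hdepY h]
  have hdep1 : DependsOn (fun _ : Config E => (1 : R)) (tailCoins arcs {w, v})ᶜ :=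
    fun _ _ _ => rfl
  have hmX : ∀ ω ∈ avoidEvent arcs s {t}, marker (R := R) arcs s a ω = X₀ ω := by
    intro ω hω
    have hr := reach_iff_trace hclosed hω ha
    simp only [hX₀, marker, hr, hD₀]
  have hmY : ∀ ω ∈ avoidEvent arcs s {t}, marker (R := R) arcs s b ω = Y₀ ω := by
    intro ω hω
    have hr := reach_iff_trace hclosed hω hb
    simp only [hY₀, marker, hr, hD₀]
  have hmXY : ∀ ω ∈ avoidEvent arcs s {t},
      marker (R := R) arcs s a ω * marker (R := R) arcs s b ω = X₀ ω * Y₀ ω :=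
    fun ω hω => by rw [hmX ω hω, hmY ω hω]
  have eX := twoPendant_mass p hclosed hT hwv s hu hdepX hmX
  have eY := twoPendant_mass p hclosed hT hwv s hu hdepY hmY
  have eXY := twoPendant_mass p hclosed hT hwv s hu hdepXY hmXY
  have e1 := twoPendant_mass p hclosed hT hwv s hu hdep1 (fun _ _ => rfl)
  simp only [← prob_eq_massE_one] at e1
  -- assemble
  unfold DARC phiC
  simp only []
  rw [e1.1, eX.1, eY.1, e1.2, eX.2, eY.2, eXY.2]
  exact twoPendant_alg hℓ₀ hℓ₁ hℓ₂ hℓ₃ hP₀ hP₁ hP₂ hP₃ hQ₂ hQ₃ hΛ hQ₃P hρ hcov₀ hcov₁ hcov₂'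
    hcov₃' hA₀₂ hA₁₃ hA₂₃ hA₂' hA₃' hB₀₂ hB₁₃ hB₂₃ hB₂' hB₃' hPAN hshA hshB hPAU

end Theorem

end Summit.Ventures.PercRepro2.Coin
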